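import Summits.ValiantsHypothesis.ValiantsHypothesis.Theses.TwistedDetRank
import Summits.ValiantsHypothesis.ValiantsHypothesis.Theorems.TwistedDetRankTdrSuperadditive
import Summits.ValiantsHypothesis.ValiantsHypothesis.Theorems.TwistedDetRankDirectSumToTdr
import Literature.Computability.AlgebraicComplexity.HamiltonianCycleVNP

/-!
# Crux `TwistedDetRank.FermionicNormalForm` (stmt-ValiantsHypothesis-6283) is summit-hard

CALIBRATION by the lead of line `registered` (kernel-checked, elementary): the crux X2 of route
`TwistedDetRank` ALONE implies the summit (`valiantsHypothesis_of_fermionicNormalForm`), so X1 is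
redundant in the route's target `X1 ∧ X2` and X2 is at least as hard as `VP ℂ ≠ VNP ℂ`.
Proof: under `VP ℂ = VNP ℂ` the Hamiltonian-cycle family (`hcFamily_mem_VNP`, Valiant 1979) is
p-computable and is the generalised matrix function of the class function `[cycle type = (n)]`, so
X2 writes `HC_n` as `Σ_{t<r} det(X ∘ E_t)` with `r ≤ 2^((log₂ n + c)^c)`.  BLOCK-SWAP FLATTENING
(§3–§5): for `n = 2a`, `a = 2k+2`, the permutation `σ_{p,q}` of `Fin a ⊔ Fin a`
(`inl i ↦ inr (p i)`, `inr i ↦ inl (q i)`) has multiplicative cone elements and sign, and is an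
`n`-cycle iff `q p` is an `a`-cycle; with pair-swap involutions `π_x` (`x : Fin (k+1) → Bool`),
`p_x = π_x`, `q_y = c π_y` (`c = finRotate a`): `q_x p_x = c`, while `q_y p_x` has a fixed point for
`x ≠ y`.  The coefficient identity on these test permutations reads `𝟙 = U · V` with `U` of size
`2^{k+1} × r`, so `2^{k+1} ≤ r`; at `n = 2^{j+2}` this gives `2^j ≤ (j + 2 + c)^c` for all `j`,
absurd (`directSumToTdr_exists_pow_add_lt`).  References: Valiant, STOC 1979; Bürgisser 2000,
Thm. 2.10, (2.3); Landsberg 2017, §6 (Young flattenings).  No named facts assumed; the `def`s are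
proof gadgets, not route objects.
-/

-- single-conjunct layout: Sub = Summit, duplicated namespace component intended
set_option linter.dupNamespace false

noncomputable section

namespace Summit.ValiantsHypothesis.ValiantsHypothesis.Theorems.TwistedDetRankFermionicNormalForm

open Equiv MvPolynomial Literature.Computability.AlgebraicComplexity
open scoped BigOperators

/-! ## §1 Coefficient form of a twisted representation -/

/-- If `Σ_σ C(g σ) Π_i X(σ i, i) = Σ_t det(X ∘ E_t)` then `g σ = Σ_t sgn σ · Π_i E_t (σ i) i` for every
`σ` (compare the coefficients of the permutation monomial of `σ`). [folklore] -/
theorem repr_of_gmf_eq {n r : ℕ} (g : Perm (Fin n) → ℂ) (E : Fin r → Matrix (Fin n) (Fin n) ℂ)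
    (h : (∑ σ : Perm (Fin n), C (g σ) * ∏ i, (X (σ i, i) : MvPolynomial (Fin n × Fin n) ℂ)) =
      ∑ t, (Matrix.of fun i j => C (E t i j) * X (i, j)).det) (σ : Perm (Fin n)) :
    g σ = ∑ t, ((Perm.sign σ : ℤ) : ℂ) * ∏ i, E t (σ i) i := by
  have hl : coeff (permMonomial σ) (∑ τ : Perm (Fin n), C (g τ) *
      ∏ i, (X (τ i, i) : MvPolynomial (Fin n × Fin n) ℂ)) = g σ := by
    simp_rw [TwistedDetRankTdrSuperadditive.prod_X_eq_monomial, C_mul_monomial, mul_one]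
    exact TwistedDetRankTdrSuperadditive.coeff_permMonomial_sum_monomial g σ
  have hr : coeff (permMonomial σ) (∑ t, (Matrix.of fun i j => C (E t i j) *
      (X (i, j) : MvPolynomial (Fin n × Fin n) ℂ)).det) =
      ∑ t, ((Perm.sign σ : ℤ) : ℂ) * ∏ i, E t (σ i) i := by
    rw [coeff_sum]
    exact Finset.sum_congr rfl fun t _ =>
      TwistedDetRankTdrSuperadditive.coeff_permMonomial_twistedDet (E t) σ
  have hc := congrArg (coeff (permMonomial σ)) h
  rw [hl, hr] at hc
  exact hc

/-! ## §2 Cycle types are invariant under transport of structure -/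

/-- `cycleType` is invariant under `Equiv.permCongr` (via `Equiv.Perm.cycleType_extendDomain`
with the trivial subtype). [folklore] -/
theorem cycleType_permCongr {α β : Type*} [Fintype α] [DecidableEq α] [Fintype β] [DecidableEq β]
    (e : α ≃ β) (σ : Perm α) : (e.permCongr σ).cycleType = σ.cycleType := by
  let f : α ≃ {b : β // True} := e.trans (Equiv.subtypeUnivEquiv fun _ => trivial).symm
  have hext : e.permCongr σ = σ.extendDomain f := by
    ext b
    have hb : b = f (e.symm b) := by simp [f]
    conv_lhs => rw [Equiv.permCongr_apply]
    conv_rhs => rw [hb, Perm.extendDomain_apply_image]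
    simp [f]
  rw [hext, Perm.cycleType_extendDomain]

/-! ## §3 The block-swap permutations `σ_{p,q}` of `A ⊔ B` -/

section Swap

variable {a : ℕ}

/-- `σ_{p,q}`: `inl i ↦ inr (p i)`, `inr i ↦ inl (q i)` on `Fin a ⊕ Fin a`. -/
def swapPerm (p q : Perm (Fin a)) : Perm (Fin a ⊕ Fin a) :=
  (Equiv.sumComm (Fin a) (Fin a) : Perm (Fin a ⊕ Fin a)) * Equiv.sumCongr p q

/-- `σ_{p,q} (inl i) = inr (p i)`. -/
@[simp] theorem swapPerm_inl (p q : Perm (Fin a)) (i : Fin a) :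
    swapPerm p q (Sum.inl i) = Sum.inr (p i) := rfl

/-- `σ_{p,q} (inr i) = inl (q i)`. -/
@[simp] theorem swapPerm_inr (p q : Perm (Fin a)) (i : Fin a) :
    swapPerm p q (Sum.inr i) = Sum.inl (q i) := rfl

/-- `σ_{p,q}` moves every point (it exchanges the two blocks). -/
theorem swapPerm_ne_self (p q : Perm (Fin a)) (z : Fin a ⊕ Fin a) : swapPerm p q z ≠ z := by
  cases z <;> simp

/-- Even powers: `σ_{p,q}^{2k} (inl z) = inl ((q p)^k z)`. -/
theorem swapPerm_pow_two_mul_inl (p q : Perm (Fin a)) (k : ℕ) (z : Fin a) :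
    (swapPerm p q ^ (2 * k)) (Sum.inl z) = Sum.inl (((q * p) ^ k) z) := by
  induction k generalizing z with
  | zero => simp
  | succ k ih =>
    rw [show 2 * (k + 1) = 2 * k + 1 + 1 by ring, pow_succ, pow_succ, Perm.mul_apply,
      Perm.mul_apply, swapPerm_inl, swapPerm_inr, ih, pow_succ, Perm.mul_apply, Perm.mul_apply]

/-- The sign of `σ_{p,q}` is `ε · sgn p · sgn q` with `ε` the sign of the block swap. -/
theorem sign_swapPerm (p q : Perm (Fin a)) :
    Perm.sign (swapPerm p q) =
      Perm.sign (Equiv.sumComm (Fin a) (Fin a) : Perm (Fin a ⊕ Fin a)) * Perm.sign p * Perm.sign q := by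
  rw [swapPerm, Perm.sign_mul, Perm.sign_sumCongr, mul_assoc]

/-- Multiplicativity of cone elements on `σ_{p,q}`:
`Π_z E(σ z, z) = (Π_i E(inr (p i), inl i)) · (Π_i E(inl (q i), inr i))`. -/
theorem prod_swapPerm (p q : Perm (Fin a)) (E : Fin a ⊕ Fin a → Fin a ⊕ Fin a → ℂ) :
    ∏ z, E (swapPerm p q z) z =
      (∏ i, E (Sum.inr (p i)) (Sum.inl i)) * ∏ i, E (Sum.inl (q i)) (Sum.inr i) := by
  rw [Fintype.prod_sum_type]
  rfl

/-- If `q p` has a fixed point then `σ_{p,q}` is not a full cycle (`a ≥ 2`): its square fixes a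
point, while the square of a `2a`-cycle does not. -/
theorem cycleType_swapPerm_ne (ha : 2 ≤ a) (p q : Perm (Fin a)) {w : Fin a} (hw : (q * p) w = w) :
    (swapPerm p q).cycleType ≠ {Fintype.card (Fin a ⊕ Fin a)} := by
  intro hct
  have hcyc : (swapPerm p q).IsCycle := by
    rw [← Perm.card_cycleType_eq_one, hct, Multiset.card_singleton]
  have hsq : (swapPerm p q ^ 2) (Sum.inl w) = Sum.inl w := by
    have := swapPerm_pow_two_mul_inl p q 1 w
    rw [mul_one, pow_one] at this
    rw [this, hw]
  have hord : orderOf (swapPerm p q) ∣ 2 :=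
    orderOf_dvd_of_pow_eq_one ((hcyc.pow_eq_one_iff' (swapPerm_ne_self p q (Sum.inl w))).2 hsq)
  have hsupp : (swapPerm p q).support.card = Fintype.card (Fin a ⊕ Fin a) := by
    have h := Perm.sum_cycleType (swapPerm p q)
    rw [hct, Multiset.sum_singleton] at h
    exact h.symm
  rw [hcyc.orderOf, hsupp, Fintype.card_sum, Fintype.card_fin] at hord
  have := Nat.le_of_dvd (by norm_num) hord; omega

/-- If `q p = finRotate a` (`a ≥ 1`) then `σ_{p,q}` is a full cycle: the orbit of `inl 0` is
`inl (c^k 0)`, `inr (p (c^k 0))`, i.e. everything. -/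
theorem cycleType_swapPerm_eq {b : ℕ} (p q : Perm (Fin (b + 1))) (hqp : q * p = finRotate (b + 1)) :
    (swapPerm p q).cycleType = {Fintype.card (Fin (b + 1) ⊕ Fin (b + 1))} := by
  set σ := swapPerm p q with hσ
  -- every point is in the orbit of `inl 0`
  have horb : ∀ z : Fin (b + 1) ⊕ Fin (b + 1), Perm.SameCycle σ (Sum.inl 0) z := by
    have hinl : ∀ w : Fin (b + 1), (σ ^ (2 * (w : ℕ))) (Sum.inl 0) = Sum.inl w := by
      intro w
      rw [hσ, swapPerm_pow_two_mul_inl, hqp, finRotate_pow_val_apply, zero_add]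
    intro z
    rcases z with w | w
    · exact ⟨(2 * (w : ℕ) : ℕ), by rw [zpow_natCast, hinl]⟩
    · refine ⟨(2 * ((p⁻¹ w : Fin (b + 1)) : ℕ) + 1 : ℕ), ?_⟩
      rw [zpow_natCast, pow_succ', Perm.mul_apply, hinl, hσ, swapPerm_inl, Perm.inv_def,
        Equiv.apply_symm_apply]
  have hcyc : σ.IsCycle :=
    ⟨Sum.inl 0, swapPerm_ne_self p q _, fun z _ => horb z⟩
  have hsupp : σ.support = Finset.univ :=
    Finset.eq_univ_of_forall fun z => Perm.mem_support.2 (swapPerm_ne_self p q z)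
  rw [hcyc.cycleType, hsupp, Finset.card_univ]

end Swap

/-! ## §4 The bit gadget on `Fin (2k+2)`: pair swaps and the standard cycle -/

section Bits

variable {k : ℕ}

/-- Pairs `(i, j) ↦ 2i + j`: `Fin (k+1) × Fin 2 ≃ Fin (2k+2)`. -/
def pairEquiv (k : ℕ) : Fin (k + 1) × Fin 2 ≃ Fin (2 * k + 2) :=
  finProdFinEquiv.trans (finCongr (by ring))

/-- `pairEquiv k (i, j) = 2i + j` as a natural number. -/
@[simp] theorem pairEquiv_val (p : Fin (k + 1) × Fin 2) :
    ((pairEquiv k p : Fin (2 * k + 2)) : ℕ) = (p.2 : ℕ) + 2 * (p.1 : ℕ) := rfl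

/-- Flip the second coordinate of the pairs selected by `z`. -/
def pairFlip (z : Fin (k + 1) → Bool) : Perm (Fin (k + 1) × Fin 2) :=
  Equiv.prodCongrRight fun i => if z i then Equiv.swap (0 : Fin 2) 1 else Equiv.refl (Fin 2)

/-- `pairFlip z (i, j) = (i, swap j)` if `z i`, else `(i, j)`. -/
theorem pairFlip_apply (z : Fin (k + 1) → Bool) (i : Fin (k + 1)) (j : Fin 2) :
    pairFlip z (i, j) = (i, if z i then Equiv.swap (0 : Fin 2) 1 j else j) := by
  simp only [pairFlip, Equiv.prodCongrRight_apply]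
  split <;> rfl

/-- `pairFlip z` is an involution. -/
theorem pairFlip_pairFlip (z : Fin (k + 1) → Bool) (p : Fin (k + 1) × Fin 2) :
    pairFlip z (pairFlip z p) = p := by
  obtain ⟨i, j⟩ := p
  rw [pairFlip_apply, pairFlip_apply]
  split
  · simp [Equiv.swap_apply_self]
  · rfl

/-- The mixed product fixes the second point of a pair on which `x` and `y` disagree. -/
theorem pairFlip_pairFlip_of_ne (x y : Fin (k + 1) → Bool) (i : Fin (k + 1)) (hi : x i ≠ y i) :
    pairFlip y (pairFlip x (i, 1)) = (i, 0) := by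
  rw [pairFlip_apply, pairFlip_apply]
  cases hx : x i <;> cases hy : y i <;> simp_all [Equiv.swap_apply_right]

/-- The pair-swap involution `π_z` of `Fin (2k+2)`. -/
def pairSwap (z : Fin (k + 1) → Bool) : Perm (Fin (2 * k + 2)) :=
  (pairEquiv k).permCongr (pairFlip z)

/-- `π_z` acts on pairs through `pairFlip z`. -/
theorem pairSwap_apply (z : Fin (k + 1) → Bool) (p : Fin (k + 1) × Fin 2) :
    pairSwap z (pairEquiv k p) = pairEquiv k (pairFlip z p) := by
  simp [pairSwap, Equiv.permCongr_apply]

/-- `π_z` is an involution. -/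
theorem pairSwap_mul_self (z : Fin (k + 1) → Bool) : pairSwap z * pairSwap z = 1 := by
  ext w
  obtain ⟨p, rfl⟩ := (pairEquiv k).surjective w
  rw [Perm.mul_apply, pairSwap_apply, pairSwap_apply, pairFlip_pairFlip, Perm.one_apply]

/-- The standard cycle advances inside a pair: `c (2i) = 2i + 1`. -/
theorem finRotate_pairEquiv_zero (i : Fin (k + 1)) :
    finRotate (2 * k + 2) (pairEquiv k (i, 0)) = pairEquiv k (i, 1) := by
  apply Fin.ext
  have hv0 : ((pairEquiv k (i, 0) : Fin (2 * k + 2)) : ℕ) = 2 * (i : ℕ) := by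
    rw [pairEquiv_val]
    simp
  have hv1 : ((pairEquiv k (i, 1) : Fin (2 * k + 2)) : ℕ) = 2 * (i : ℕ) + 1 := by
    rw [pairEquiv_val]
    simp only [Fin.isValue, Fin.val_one]
    ring
  rw [hv1, finRotate_apply, Fin.val_add_one]
  split_ifs with hlast
  · have h := congrArg Fin.val hlast
    rw [hv0, Fin.val_last] at h; omega
  · rw [hv0]

/-- `p_x = π_x`, `q_y = c π_y`: on the diagonal `q_x p_x = c`. -/
theorem gadget_diag (x : Fin (k + 1) → Bool) :
    (finRotate (2 * k + 2) * pairSwap x) * pairSwap x = finRotate (2 * k + 2) := by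
  rw [mul_assoc, pairSwap_mul_self, mul_one]

/-- Off the diagonal `q_y p_x` has a fixed point. -/
theorem gadget_offdiag {x y : Fin (k + 1) → Bool} (hxy : x ≠ y) :
    ∃ w, ((finRotate (2 * k + 2) * pairSwap y) * pairSwap x) w = w := by
  obtain ⟨i, hi⟩ : ∃ i, x i ≠ y i := by
    by_contra h
    push Not at h
    exact hxy (funext h)
  refine ⟨pairEquiv k (i, 1), ?_⟩
  rw [Perm.mul_apply, Perm.mul_apply, pairSwap_apply, pairSwap_apply, pairFlip_pairFlip_of_ne x y i hi,
    finRotate_pairEquiv_zero]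

end Bits

/-! ## §5 The flattening: a twisted representation of `HC_{4k+4}` has length `≥ 2^{k+1}` -/

section Flattening

variable {k : ℕ}

/-- The test permutations `σ_{x,y} = σ_{p_x, q_y}` transported to `Fin (a + a)`, `a = 2k+2`. -/
def testPerm (x y : Fin (k + 1) → Bool) : Perm (Fin ((2 * k + 2) + (2 * k + 2))) :=
  finSumFinEquiv.permCongr (swapPerm (pairSwap x) (finRotate (2 * k + 2) * pairSwap y))

/-- The test permutation `σ_{x,y}` is a full cycle iff `x = y`. -/
theorem cycleType_testPerm_iff (x y : Fin (k + 1) → Bool) :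
    (testPerm x y).cycleType = {(2 * k + 2) + (2 * k + 2)} ↔ x = y := by
  rw [testPerm, cycleType_permCongr]
  have hcard : Fintype.card (Fin (2 * k + 2) ⊕ Fin (2 * k + 2)) = (2 * k + 2) + (2 * k + 2) := by
    simp
  rw [← hcard]
  constructor
  · intro h
    by_contra hxy
    obtain ⟨w, hw⟩ := gadget_offdiag (k := k) hxy
    exact cycleType_swapPerm_ne (by omega) _ _ hw h
  · rintro rfl
    have h := cycleType_swapPerm_eq (b := 2 * k + 1) (pairSwap x) (finRotate (2 * k + 2) * pairSwap x)
      (gadget_diag x)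
    exact h

/-- **Flattening bound.** If the indicator of the `n`-cycles, `n = 4k+4`, is a cone sum of length
`r` (coefficient form of `HC_n = Σ_{t<r} det(X ∘ E_t)`), then `2^{k+1} ≤ r`: on the test
permutations the identity reads `𝟙 = U · V` for a `2^{k+1} × r` matrix `U`. [folklore; Landsberg 2017 §6] -/
theorem two_pow_le_of_repr {r : ℕ}
    (E : Fin r → Matrix (Fin ((2 * k + 2) + (2 * k + 2))) (Fin ((2 * k + 2) + (2 * k + 2))) ℂ)
    (hrep : ∀ σ : Perm (Fin ((2 * k + 2) + (2 * k + 2))),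
      (if σ.cycleType = {(2 * k + 2) + (2 * k + 2)} then (1 : ℂ) else 0) =
        ∑ t, ((Perm.sign σ : ℤ) : ℂ) * ∏ i, E t (σ i) i) :
    2 ^ (k + 1) ≤ r := by
  classical
  set eS : Fin (2 * k + 2) ⊕ Fin (2 * k + 2) ≃ Fin ((2 * k + 2) + (2 * k + 2)) := finSumFinEquiv
    with heS
  set c : Perm (Fin (2 * k + 2)) := finRotate (2 * k + 2) with hc
  -- the factors
  set ε : ℂ := ((Perm.sign (Equiv.sumComm (Fin (2 * k + 2)) (Fin (2 * k + 2)) :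
      Perm (Fin (2 * k + 2) ⊕ Fin (2 * k + 2))) : ℤ) : ℂ) with hε
  set U : Matrix (Fin (k + 1) → Bool) (Fin r) ℂ := fun x t =>
    ε * ((Perm.sign (pairSwap x) : ℤ) : ℂ) *
      ∏ i, E t (eS (Sum.inr (pairSwap x i))) (eS (Sum.inl i)) with hU
  set V : Matrix (Fin r) (Fin (k + 1) → Bool) ℂ := fun t y =>
    ((Perm.sign (c * pairSwap y) : ℤ) : ℂ) *
      ∏ i, E t (eS (Sum.inl ((c * pairSwap y) i))) (eS (Sum.inr i)) with hV
  have hUV : U * V = 1 := by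
    ext x y
    rw [Matrix.mul_apply, Matrix.one_apply]
    have h := hrep (testPerm x y)
    rw [if_congr (cycleType_testPerm_iff x y) rfl rfl] at h
    rw [h]
    refine Finset.sum_congr rfl fun t _ => ?_
    -- sign
    have hsign : ((Perm.sign (testPerm x y) : ℤ) : ℂ) =
        ε * ((Perm.sign (pairSwap x) : ℤ) : ℂ) * ((Perm.sign (c * pairSwap y) : ℤ) : ℂ) := by
      rw [testPerm, Perm.sign_permCongr, sign_swapPerm, hε, hc]
      push_cast
      ring
    -- product
    have hprod : ∏ i, E t (testPerm x y i) i =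
        (∏ i, E t (eS (Sum.inr (pairSwap x i))) (eS (Sum.inl i))) *
          ∏ i, E t (eS (Sum.inl ((c * pairSwap y) i))) (eS (Sum.inr i)) := by
      rw [← Equiv.prod_comp eS (fun i => E t (testPerm x y i) i)]
      have hq : ∀ z, testPerm x y (eS z) = eS (swapPerm (pairSwap x) (c * pairSwap y) z) := by
        intro z
        simp [testPerm, heS, hc, Equiv.permCongr_apply]
      simp_rw [hq]
      exact prod_swapPerm (pairSwap x) (c * pairSwap y) (fun u v => E t (eS u) (eS v))
    rw [hsign, hprod, hU, hV]
    ring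
  have h1 : (1 : Matrix (Fin (k + 1) → Bool) (Fin (k + 1) → Bool) ℂ).rank = 2 ^ (k + 1) := by
    rw [Matrix.rank_one, Fintype.card_fun, Fintype.card_bool, Fintype.card_fin]
  have h2 : (U * V).rank ≤ r :=
    (Matrix.rank_mul_le_left U V).trans ((Matrix.rank_le_card_width U).trans (Fintype.card_fin r).le)
  rw [hUV, h1] at h2
  exact h2

end Flattening

/-! ## §6 The crux is summit-hard -/

/-- `HC_n` is the generalised matrix function of the class function `[cycle type = (n)]`. -/
theorem hcPoly_eq_gmf (n : ℕ) :
    (∑ σ : Perm (Fin n), C (if σ.cycleType = {n} then (1 : ℂ) else 0) *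
        ∏ i : Fin n, (X (σ i, i) : MvPolynomial (Fin n × Fin n) ℂ)) = hcPoly (Fin n) ℂ := by
  rw [hcPoly, Matrix.hamiltonianCycleSum, Finset.sum_filter, Fintype.card_fin]
  refine Finset.sum_congr rfl fun σ _ => ?_
  split_ifs with h
  · simp [Matrix.mvPolynomialX_apply]
  · simp

/-- **CALIBRATION — the crux X2 alone implies the summit.**  `FermionicNormalForm → VP ℂ ≠ VNP ℂ`:
under `VP ℂ = VNP ℂ` the Hamiltonian-cycle family (in `VNP`, tree `hcFamily_mem_VNP`) is
p-computable; it is the GMF of the class function `[cycle type = (n)]`, so X2 bounds its twisted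
representations by `2^((log₂ n + c)^c)`, while the block-swap flattening (`two_pow_le_of_repr`)
forces length `≥ 2^{n/4}` at `n = 2^{j+2}`; `2^j ≤ (j + 2 + c)^c` fails for large `j`
(`directSumToTdr_exists_pow_add_lt`).  Hence the route's X1 (`TdrPerNotQP`) is redundant in its
target `X1 ∧ X2`, and X2 is at least as hard as `ValiantsHypothesis`. [folklore] -/
theorem valiantsHypothesis_of_fermionicNormalForm :
    Summit.ValiantsHypothesis.ValiantsHypothesis.Theses.TwistedDetRank.FermionicNormalForm →
      _root_.ValiantsHypothesis := by
  intro hX2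
  show VP ℂ ≠ VNP ℂ
  intro hEq
  -- `HC` is p-computable under `VP = VNP`
  have hmem : hcFamily ℂ ∈ VP ℂ := by rw [hEq]; exact hcFamily_mem_VNP ℂ
  have hP : IsPComputable (fun n => hcPoly (Fin n) ℂ) :=
    ((mem_VP_ofFintype_iff_holds (fun n => hcPoly (Fin n) ℂ)).1 hmem).2
  -- as the GMF of a class function
  have hgmf : (fun n => ∑ σ : Perm (Fin n), C (if σ.cycleType = {n} then (1 : ℂ) else 0) *
      ∏ i : Fin n, (X (σ i, i) : MvPolynomial (Fin n × Fin n) ℂ)) = fun n => hcPoly (Fin n) ℂ :=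
    funext hcPoly_eq_gmf
  have hPχ : IsPComputable (fun n => ∑ σ : Perm (Fin n),
      C (if σ.cycleType = {n} then (1 : ℂ) else 0) *
        ∏ i : Fin n, (X (σ i, i) : MvPolynomial (Fin n × Fin n) ℂ)) := by rw [hgmf]; exact hP
  have hcl : ∀ (n : ℕ) (σ τ : Perm (Fin n)),
      (if (τ * σ * τ⁻¹).cycleType = {n} then (1 : ℂ) else 0) =
        (if σ.cycleType = {n} then (1 : ℂ) else 0) := by
    intro n σ τ
    rw [Perm.cycleType_conj]
  obtain ⟨c, hc⟩ := hX2 (fun n σ => if σ.cycleType = {n} then (1 : ℂ) else 0) hcl hPχ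
  -- growth: `2^j ≤ (j + 2 + c)^c` for all `j` is absurd
  obtain ⟨j, hj⟩ := directSumToTdr_exists_pow_add_lt 1 one_pos (c + 2) c
  set k : ℕ := 2 ^ j - 1 with hk
  have hk1 : k + 1 = 2 ^ j := by have := Nat.one_le_two_pow (n := j); omega
  have hn : (2 * k + 2) + (2 * k + 2) = 2 ^ (j + 2) := by rw [pow_succ, pow_succ, ← hk1]; ring
  obtain ⟨r, hr, E, hE⟩ := hc ((2 * k + 2) + (2 * k + 2)) (by omega)
  rw [hn, Nat.log_pow one_lt_two] at hr
  have hrep := repr_of_gmf_eq _ E hE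
  have h2 : 2 ^ (k + 1) ≤ r := two_pow_le_of_repr E hrep
  rw [hk1] at h2
  -- `2^(2^j) ≤ r ≤ 2^((j+2+c)^c)` gives `2^j ≤ (j+2+c)^c`, contradicting `hj`
  have h3 : 2 ^ j ≤ (j + (c + 2)) ^ c := by
    have h4 : 2 ^ (2 ^ j) ≤ 2 ^ ((j + 2 + c) ^ c) := h2.trans hr
    have h5 := (Nat.pow_le_pow_iff_right (by norm_num : 1 < 2)).1 h4
    rw [show j + (c + 2) = j + 2 + c by ring]
    exact h5
  have h6 : ((2 ^ j : ℕ) : ℝ) ≤ (((j + (c + 2)) ^ c : ℕ) : ℝ) := by exact_mod_cast h3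
  push_cast at h6 hj
  linarith

end Summit.ValiantsHypothesis.ValiantsHypothesis.Theorems.TwistedDetRankFermionicNormalForm

end
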